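/-
Copyright (c) 2026 the pub-hodgecm-mathlib formalisation cell (harness21).  Prover seat hodgecm-mathlib-K2E3-p17 (g0) (WILD ENGINE line lead, K2E3-plan (g1) BATCH #2),
Track B «K2-LIT» ∕ h413, unit U5Kazhdan of the line `K2_E3_EllipticInputs`: THE 17W ENGINE SOCKET `sig_K2E3PseudoCoeffExistsNonScWild` PAID BY NAME.  2026-09-03.
-/
import Summits.HodgeConjecture.HodgeConjecture.Theorems.K2E3PseudoCoeffExistsNonScWildOfH61          -- ★ (this seat): `pseudoCoeffExistsNonScWild_of_h61W` (T2b-W + the place split), over ★ 58-W-W ∕ 53-W ∕ 48-W ∕ H-W ∕ (A)-W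
import Summits.HodgeConjecture.HodgeConjecture.Theorems.K2E3EPInducedTraceZeroAtDatumDischargeWild   -- ★ 61b-W (K2E3-p16): `smoothTrace_cmPrincipalSeries_epFunction_eq_zero_of_ramificationIdx_ne_one` (the row-61 input at every ramified place)
import HarnessLib

/-!
# K2_E3 road (h413 = stmt-HodgeConjecture-24833), unit U5Kazhdan — THE 17W ENGINE SOCKET `sig_K2E3PseudoCoeffExistsNonScWild` PAID BY NAME: at a WILD place every elliptic
# non-supercuspidal class of `U(Φ₃)(L⁺_v)` has a pseudo-coefficient (the Schneider–Stuhler Euler–Poincaré road over Track A U0's wild lattice tree)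

Cell `pub/hodgecm-mathlib` (D-0151), Track B; seat K2E3-p17 (g0) = WILD ENGINE LINE LEAD (K2E3-plan (g1) DEALS BATCH #2 22:15:20Z; FILE ↦ SEAT MAP 22:22:15Z).
THEOREMS ONLY (no definition ∕ instance ∕ notation ∕ named fact ∕ `sorry`); ★-only imports (never a `Cruxes/…/Lines` module).

WHAT.  `pseudoCoeffExistsNonScWild` — the statement of the U5Kazhdan ED. 2 socket `sig_K2E3PseudoCoeffExistsNonScWild` (bytes = this seat's cand 31e988ba1ffe787a: the WILD
place-token twin of ★ (T3) `exists_isPseudoCoeff_of_not_wild`, `hv ↦ hw : ¬ (v unramified in L ∨ |2|_v = 1)`; `Pl` unfolded), PROVED: ★ `pseudoCoeffExistsNonScWild_of_h61W` with its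
row-61 input discharged by ★ 61b-W `K2E3EPInducedTraceZeroAtDatumDischargeWild.smoothTrace_cmPrincipalSeries_epFunction_eq_zero_of_ramificationIdx_ne_one` (K2E3-p16).  The whole
wild tower behind it: (S)-WILD ★ p855217 (K2E3-p21), the mechanical layer ★ 48-W∕1 (p855174), 48-W∕2 (K2E4-p21), 53-W (p855224), H-W (p855220, K2E3-p15), (A)-W (p855252),
FILE 1∕2∕4-W (K2E3-p21∕p19∕p18), 61b-W (K2E3-p16), 58-W-W (p855272), T2b-W (★ OfH61 §1).  CONSEQUENCE: row #17 `sig_K2E3PseudoCoeffExistsElliptic` is PAID BY NAME by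
★ p855141 `K2E3PseudoCoeffExistsEllipticOfWild.pseudoCoeffExistsElliptic_of_nonScWild pseudoCoeffExistsNonScWild` (the dealer re-ties it DERIVED in U5Kazhdan ED. 2∕3).
* §1 **`pseudoCoeffExistsNonScWild`** — PAYS 17W.

HONEST LABEL: HC_CM is proved only modulo the 7 printed citations (2 remaining named inputs: hLiu418 = stmt-HodgeConjecture-24832, h413 =
stmt-HodgeConjecture-24833) until rung 0 closes; `--supports stmt-HodgeConjecture-24833` helper; it pays the E3 sigs-table socket 17W (and, composed with ★ p855141, row #17) —
it retires no organ letter by itself.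

## References
* [SchneiderStuhler1997] P. Schneider, U. Stuhler, *Representation theory and sheaves on the Bruhat–Tits building*, Publ. Math. IHÉS 85 (1997): Thm. III.4.16, §III.4.
* [Kottwitz1988] R. E. Kottwitz, *Tamagawa numbers*, Ann. of Math. 127 (1988): §2 Theorem 2.
* [Rogawski1990] J. D. Rogawski, *Automorphic Representations of Unitary Groups in Three Variables* (1990): §12.6 p. 187.
-/

set_option autoImplicit false
-- the mandated namespace has the single-problem summit's repeated segment (`HodgeConjecture.HodgeConjecture`)
set_option linter.dupNamespace false

noncomputable section

open NumberField IsDedekindDomain MeasureTheory Filter Topology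
open scoped Matrix MatrixGroups Valued NNReal
open Literature.NumberTheory.Rogawski1990 Literature.NumberTheory.Rogawski1990.Ch12Sec5
open Literature.NumberTheory.Automorphic Literature.NumberTheory.Automorphic.UnitaryGroup

namespace Summit.HodgeConjecture.HodgeConjecture.Cruxes.H413.K2E3PseudoCoeffExistsNonScWild

open Summit.HodgeConjecture.HodgeConjecture.Cruxes.H413
open Summit.HodgeConjecture.HodgeConjecture.Cruxes.H413.F0P3cStCharTSTorusDefs
open Summit.HodgeConjecture.HodgeConjecture.Cruxes.H413.K2E3PseudoCoeffExistsNonScWildOfH61 (pseudoCoeffExistsNonScWild_of_h61W)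
open Summit.HodgeConjecture.HodgeConjecture.Cruxes.H413.K2E3EPInducedTraceZeroAtDatumDischargeWild (smoothTrace_cmPrincipalSeries_epFunction_eq_zero_of_ramificationIdx_ne_one)

/-! ## §1  The 17W engine socket, PAID -/

set_option maxHeartbeats 1600000 in
set_option synthInstance.maxHeartbeats 400000 in
-- statement-level instance-term unification on the CM carriers (the socket's own budget line)
/-- **17W — `sig_K2E3PseudoCoeffExistsNonScWild` PAID BY NAME**: at a non-split place `v` of `L⁺` with `¬ (v unramified in L ∨ |2|_v = 1)` (a WILD place), at the §12.5 datum
`𝔇` on `U(Φ₃)(L⁺_v)` with the junction pins (COMPAT `hμG horb hreg`, the pin `hE`, (M1∀) `hM1`), EVERY elliptic NON-supercuspidal class has a pseudo-coefficient — print: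
«The existence of pseudo-coefficients follows from [K], Theorem 4.1» [Rogawski1990, §12.6 p. 187], here by the Schneider–Stuhler Euler–Poincaré function on the WILD lattice
tree (no [K]).  Statement = the socket's bytes VERBATIM (`Pl` unfolded); proof = ★ `pseudoCoeffExistsNonScWild_of_h61W` ∘ ★ 61b-W.
[cite: Rogawski1990, §12.6 p. 187] [cite: SchneiderStuhler1997, Thm. III.4.16] [cite: Kottwitz1988, §2 Theorem 2] -/
theorem pseudoCoeffExistsNonScWild :
  ∀ (L : Type) [Field L] [NumberField L] [IsCMField L] (v : HeightOneSpectrum (𝓞 ↥(maximalRealSubfield L)))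
    (hns : ∀ w : PlacesOver L v, IsCMField.complexConj L • w.1 = w.1) (hw : ¬ (Algebra.IsUnramifiedIn (𝓞 L) v.asIdeal ∨ Valued.v (2 : v.adicCompletion ↥(maximalRealSubfield L)) = 1))
    [MeasurableSpace (Gqs L v)] [BorelSpace (Gqs L v)]
    [∀ γ : Gqs L v, MeasurableSpace (Gqs L v ⧸ Subgroup.centralizer ({γ} : Set (Gqs L v)))] [∀ γ : Gqs L v, BorelSpace (Gqs L v ⧸ Subgroup.centralizer ({γ} : Set (Gqs L v)))]
    [MeasurableSpace (Gqs L v ⧸ Subgroup.center (Gqs L v))]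
    {H : Type} [Group H] [TopologicalSpace H] [IsTopologicalGroup H] [MeasurableSpace H]
    (νQv : Measure (Gqs L v)) [νQv.IsHaarMeasure] [νQv.IsMulRightInvariant] (mQv : OrbitalMeasureFamily (Gqs L v))
    (hcanQ : mQv.IsCanonical (fun γ => IsRegularElt (γ.val : GL (Fin 3) (UnitaryGroup.LocalRing L v))) νQv)
    (𝔇 : Ch12Sec5.EllipticData (Gqs L v) H) (hμG : 𝔇.μG = νQv) (horb : 𝔇.orb = mQv)
    (hreg : ∀ γ : Gqs L v, γ ∈ 𝔇.regG ↔ IsRegularElt (γ.val : GL (Fin 3) (UnitaryGroup.LocalRing L v)))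
    (hE : ∀ γ : Gqs L v, γ ∈ 𝔇.ellG ↔ IsRegularElt (γ.val : GL (Fin 3) (UnitaryGroup.LocalRing L v)) ∧ γ ∉ hyperbolicSet L v)
    (hM1 : ∀ π : IrrClass (Gqs L v), Measurable (𝔇.char π) ∧ LocallyIntegrable (𝔇.char π) 𝔇.μG ∧ (∀ x ∈ 𝔇.regG, ∀ᶠ y in 𝓝 x, 𝔇.char π y = 𝔇.char π x) ∧
      ∀ φ : Gqs L v → ℂ, IsLocSmooth φ → π.smoothTrace 𝔇.μG φ = ∫ x, φ x * 𝔇.char π x ∂𝔇.μG),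
    ∀ π : IrrClass (Gqs L v), 𝔇.IsEllipticRep π → ¬ π.IsSupercuspidal → ∃ f : Gqs L v → ℂ, 𝔇.IsPseudoCoeff π f :=
  pseudoCoeffExistsNonScWild_of_h61W fun L _ _ _ v _ _ _ νQv _ w hw _ he hϖ eA =>
    smoothTrace_cmPrincipalSeries_epFunction_eq_zero_of_ramificationIdx_ne_one L v νQv w hw he hϖ eA

end Summit.HodgeConjecture.HodgeConjecture.Cruxes.H413.K2E3PseudoCoeffExistsNonScWild

end
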